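import Mathlib
import HarnessLib
import Summits.HubbardSuperconductivity.HubbardSuperconductivity.Theorems.KLProgrammeKLRegimeCountertermJacksonKernelL1AllOrders
import Summits.HubbardSuperconductivity.HubbardSuperconductivity.Theorems.KLProgrammeKLRegimeFlowPieceJetsOfReadJets

/-!
# K3 under scheme F (stmt 20437 `KLRegimeEngineV17F2`, stub (C) doors (B)/(C)): the jets of a JACKSON FLOW PIECE at EVERY order from the GRADIENT row —
# `‖Dʲ evalM (jacksonFrame d (klFrameExtFn μ ν_n(K)))‖ ≤ 2ʲ·(π⁸/4)·2^{j−1}·(d+1)^{j−1}·curveJetBar (curveExtC X c) (curveExtC X c') U 1 n`, `j ≥ 1`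

Cell gate-hubbard-kl, seat p2 g11 (plan g17 ruling (α) on question (D), KL STATUS 2026-08-27 l.3040/l.3160, realised at the Jackson level).  The (I-F jets)
supplier `…FlowPieceJetsOfReadJets.norm_iteratedFDeriv_evalM_jacksonFrame_klFrameExtFn_le_curveJetBar` (k3c3-p3) moves ALL derivatives onto the tube extension
and so stops at the reading's order `4`; the position moments of order `r ≤ 4` of door (B) (and (C)) read sampled differences of order `≤ 6`, i.e. frame-piece
jets of order `5, 6`.  Here ONE derivative goes onto the extension (its gradient, `≤ curveJetBar … 1 n ≍ U²·4^{−n}`) and `j − 1` onto the Jackson kernels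
(`…JacksonKernelL1AllOrders.norm_iteratedFDeriv_convInt_jker_le_all`, the mixed Jackson–Bernstein bound at every order): at `d = klFlowDeg n = 2^7·4^n` this is
`C_j·U²·4^{(j−2)n}` — the admissible-piece law at EVERY order `j ≥ 1`, constants `C_j = 2ʲ·(π⁸/4)·2^{j−1}·2^{8(j−1)}·(curveExtC X c 1 + curveExtC X c' 1·|U|)`.

* §1 `hasDerivAt_onM_fst/snd`, `continuous_onM_partial`, `abs_onM_partial_le` — first partials of a frame function `F` through `onM F ∈ C¹`;
* §2 **`norm_iteratedFDeriv_evalM_jacksonFrame_le_mixed_all`** — for a continuous symmetric frame `F` with `onM F ∈ C¹`, `‖D(onM F)‖ ≤ a₁`: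
  `‖Dʲ evalM (jacksonFrame d F) q‖ ≤ 2ʲ·((π⁸/4)·2^{j−1}·(d+1)^{j−1}·a₁)` for every `j ≥ 1` (the `C^j` of the convolution is that of `evalM` of a `TrigPolyC4v`);
* §3 **`norm_iteratedFDeriv_evalM_jacksonFrame_klFrameExtFn_le_all`** — reading jets `|∂^k ν_n(K)| ≤ curveJetBar c c' U k n` (`k ≤ 4`, `ν_n(K)` `C⁴`) ⇒ the bound of
  the title for every `j ≥ 1`, every degree `d`, every frame `K`.

Proofs only; no definitions; nothing about the model's sizes is asserted.  References: BGM 2006 §2.2 (2.23), §2.4 (2.36) [cite: BenfattoGiulianiMastropietro2006].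
-/

noncomputable section

namespace Summit.HubbardSuperconductivity.HubbardSuperconductivity.Theorems.KLRegimeSplit

set_option linter.dupNamespace false -- summit = problem name (single-conjunct summit), D-0017

open Real Finset MeasureTheory Literature.MathematicalPhysics.QuantumLattice Literature.MathematicalPhysics.QuantumLattice.FermiRG
open Literature.Probability.LatticeModels
open Summit.HubbardSuperconductivity.HubbardSuperconductivity.Theorems.PerturbedFermiCurve

/-! ## §1 First partials of a frame function through `onM` -/

section Partials

variable {F : FrameFn}

/-- A frame function whose `onM` is `Cᵐ` is continuous. -/
theorem continuous_of_contDiff_onM' {m : WithTop ℕ∞} (h : ContDiff ℝ m (onM F)) : Continuous F := by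
  have hK : F = fun p : Fin 2 → ℝ => onM F (WithLp.toLp 2 p) := by funext p; simp [onM]
  rw [hK]
  exact h.continuous.comp (PiLp.continuous_toLp 2 _)

/-- `∂₀` along the first coordinate: `d/du F(u,t) = D(onM F)(u,t)·e₀`. -/
theorem hasDerivAt_onM_fst (h1 : ContDiff ℝ 1 (onM F)) (s t : ℝ) :
    HasDerivAt (fun u => F ![u, t]) (fderiv ℝ (onM F) (WithLp.toLp 2 ![s, t]) (eucl 0)) s := by
  have hfun : (fun u => F ![u, t]) = fun u => onM F (u • eucl 0 + WithLp.toLp 2 ![0, t]) := by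
    funext u; rw [← toLp_vec_fst]; simp [onM]
  rw [hfun]
  have hpath : HasDerivAt (fun u : ℝ => u • eucl 0 + WithLp.toLp 2 ![0, t]) (eucl 0) s := by
    simpa using ((hasDerivAt_id s).smul_const (eucl 0)).add_const (WithLp.toLp 2 ![0, t])
  have hd : DifferentiableAt ℝ (onM F) (s • eucl 0 + WithLp.toLp 2 ![0, t]) := (h1.differentiable one_ne_zero) _
  have h := hd.hasFDerivAt.comp_hasDerivAt s hpath
  rw [← toLp_vec_fst s t] at h
  simpa [Function.comp_def] using h

/-- `∂₁` along the second coordinate. -/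
theorem hasDerivAt_onM_snd (h1 : ContDiff ℝ 1 (onM F)) (s t : ℝ) :
    HasDerivAt (fun u => F ![s, u]) (fderiv ℝ (onM F) (WithLp.toLp 2 ![s, t]) (eucl 1)) t := by
  have hfun : (fun u => F ![s, u]) = fun u => onM F (u • eucl 1 + WithLp.toLp 2 ![s, 0]) := by
    funext u; rw [← toLp_vec_snd]; simp [onM]
  rw [hfun]
  have hpath : HasDerivAt (fun u : ℝ => u • eucl 1 + WithLp.toLp 2 ![s, 0]) (eucl 1) t := by
    simpa using ((hasDerivAt_id t).smul_const (eucl 1)).add_const (WithLp.toLp 2 ![s, 0])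
  have hd : DifferentiableAt ℝ (onM F) (t • eucl 1 + WithLp.toLp 2 ![s, 0]) := (h1.differentiable one_ne_zero) _
  have h := hd.hasFDerivAt.comp_hasDerivAt t hpath
  rw [← toLp_vec_snd s t] at h
  simpa [Function.comp_def] using h

/-- The partials are continuous. -/
theorem continuous_onM_partial (h1 : ContDiff ℝ 1 (onM F)) (i : Fin 2) :
    Continuous (fun p : Fin 2 → ℝ => fderiv ℝ (onM F) (WithLp.toLp 2 p) (eucl i)) :=
  ((h1.continuous_fderiv one_ne_zero).comp (PiLp.continuous_toLp 2 _)).clm_apply continuous_const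

/-- The partials are bounded by the gradient size. -/
theorem abs_onM_partial_le {a₁ : ℝ} (ha : ∀ q : Momentum, ‖iteratedFDeriv ℝ 1 (onM F) q‖ ≤ a₁) (i : Fin 2) (p : Fin 2 → ℝ) :
    |fderiv ℝ (onM F) (WithLp.toLp 2 p) (eucl i)| ≤ a₁ := by
  have h1 := ha (WithLp.toLp 2 p)
  rw [← norm_fderiv_eq_norm_iteratedFDeriv_one] at h1
  have he : ‖eucl i‖ = 1 := by simp [eucl]
  rw [← Real.norm_eq_abs]
  calc ‖fderiv ℝ (onM F) (WithLp.toLp 2 p) (eucl i)‖ ≤ ‖fderiv ℝ (onM F) (WithLp.toLp 2 p)‖ * ‖eucl i‖ := ContinuousLinearMap.le_opNorm _ _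
    _ ≤ a₁ := by rw [he, mul_one]; exact h1

end Partials

/-! ## §2 The mixed bound for the Jackson mean of a symmetric frame at every order -/

/-- **Jets of the Jackson-mean FRAME at every order from the GRADIENT of the smoothed function**: for a symmetric frame `F` (continuous,
`2π`-periodic, reflection- and swap-symmetric) with `onM F ∈ C¹` and `‖D(onM F)‖ ≤ a₁`,
`‖Dʲ evalM (jacksonFrame d F) q‖ ≤ 2ʲ·((π⁸/4)·2^{j−1}·(d+1)^{j−1}·a₁)` for every `j ≥ 1`. -/
theorem norm_iteratedFDeriv_evalM_jacksonFrame_le_mixed_all (d : ℕ) {F : FrameFn} (h1 : ContDiff ℝ 1 (onM F))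
    (hper : ∀ (p : Fin 2 → ℝ) (z : Fin 2 → ℤ), F (fun i => p i + z i * (2 * π)) = F p)
    (hrefl : ∀ p : Fin 2 → ℝ, F ![p 0, -p 1] = F p) (hswap : ∀ p : Fin 2 → ℝ, F ![p 1, p 0] = F p)
    {a₁ : ℝ} (ha : ∀ q : Momentum, ‖iteratedFDeriv ℝ 1 (onM F) q‖ ≤ a₁) {j : ℕ} (hj1 : 1 ≤ j) (q : Momentum) :
    ‖iteratedFDeriv ℝ j (evalM (jacksonFrame d F)) q‖ ≤ 2 ^ j * (π ^ 8 / 4 * 2 ^ (j - 1) * ((d : ℝ) + 1) ^ (j - 1) * a₁) := by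
  have hF : Continuous F := continuous_of_contDiff_onM' h1
  have hfun : evalM (jacksonFrame d F) = convInt (jkerD d 0) (jkerD d 0) F := by
    rw [← jsmooth_onM_eq_convInt d hper]
    funext q
    exact eval_jacksonFrame hF hper hrefl hswap d _
  have hJ : ContDiff ℝ j (convInt (jkerD d 0) (jkerD d 0) F) := by rw [← hfun]; exact contDiff_evalM _
  rw [hfun]
  exact norm_iteratedFDeriv_convInt_jker_le_all d hF hper hJ (continuous_onM_partial h1 0) (continuous_onM_partial h1 1)
    (hasDerivAt_onM_fst h1) (hasDerivAt_onM_snd h1) (abs_onM_partial_le ha 0) (abs_onM_partial_le ha 1) hj1 le_rfl q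

/-! ## §3 The flow pieces: every order from the reading's gradient -/

section Model

variable {L M : ℕ} [NeZero L] [NeZero M]

/-- **(E3a-F) ⇒ the Jackson flow piece's jets at EVERY order.**  For every frame `K`, scale `n`, degree `d`: if `ν := ν_n(K)` is `C⁴` with
`|∂_θ^k ν| ≤ curveJetBar c c' U k n` (`k ≤ 4`, nonnegative constants), then for every `j ≥ 1` and every `q`,
`‖Dʲ evalM (jacksonFrame d (klFrameExtFn μ ν)) q‖ ≤ 2ʲ·((π⁸/4)·2^{j−1}·(d+1)^{j−1}·curveJetBar (curveExtC X c) (curveExtC X c') U 1 n)` — at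
`d = klFlowDeg n` the `(I-F jets)` law `C_j·U²·4^{(j−2)n}` at every order (orders `≤ 4` are also served, more sharply, by
`norm_iteratedFDeriv_evalM_jacksonFrame_klFrameExtFn_le_curveJetBar`). -/
theorem norm_iteratedFDeriv_evalM_jacksonFrame_klFrameExtFn_le_all {c c' : ℕ → ℝ} (hc : ∀ k, 0 ≤ c k) (hc' : ∀ k, 0 ≤ c' k)
    {β U μ : ℝ} (hμ : μ ∈ klWindowC) {K : TrigPolyC4v} {n : ℕ} (hν : ContDiff ℝ 4 (klLocalPart L M β U μ K n))
    (hjet : ∀ k ≤ 4, ∀ θ : ℝ, |iteratedDeriv k (klLocalPart L M β U μ K n) θ| ≤ curveJetBar c c' U k n)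
    {X : ℝ} (hX : ∀ l ≤ 4, ∀ x : ℝ, ‖iteratedFDeriv ℝ l salmhoferCutoff x‖ ≤ X) (d : ℕ) {j : ℕ} (hj1 : 1 ≤ j) (q : Momentum) :
    ‖iteratedFDeriv ℝ j (evalM (jacksonFrame d (klFrameExtFn μ (klLocalPart L M β U μ K n)))) q‖ ≤
      2 ^ j * (π ^ 8 / 4 * 2 ^ (j - 1) * ((d : ℝ) + 1) ^ (j - 1) * curveJetBar (curveExtC X c) (curveExtC X c') U 1 n) := by
  set F : FrameFn := klFrameExtFn μ (klLocalPart L M β U μ K n) with hF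
  have hperν := klLocalPart_periodic (L := L) (M := M) β U μ K n
  have hcd : ContDiff ℝ 4 (onM F) := contDiff_four_onM_of_profile hν hperν hμ hF
  have h1 : ContDiff ℝ 1 (onM F) := hcd.of_le (by norm_num)
  have ha : ∀ x : Momentum, ‖iteratedFDeriv ℝ 1 (onM F) x‖ ≤ curveJetBar (curveExtC X c) (curveExtC X c') U 1 n :=
    fun x => norm_iteratedFDeriv_onM_klFrameExtFn_le_curveJetBar hc hc' hν hperν hjet hμ hX hF (by norm_num) x
  obtain ⟨hperF, hreflF, hswapF⟩ := klFrameExtFn_localPart_symmetric (L := L) (M := M) β U μ K n hμ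
  exact norm_iteratedFDeriv_evalM_jacksonFrame_le_mixed_all d h1 hperF hreflF hswapF ha hj1 q

end Model

end Summit.HubbardSuperconductivity.HubbardSuperconductivity.Theorems.KLRegimeSplit

end
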